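import Mathlib
import Literature.NumberTheory.LFunctions.Zhang2022.TypedSection11B
import Literature.NumberTheory.LFunctions.Zhang2022.Section6Statements
import Literature.NumberTheory.LFunctions.Zhang2022.Section4GaussianWeight
import HarnessLib

/-!
# Zhang (2022) §11, proof of Lemma 11.2 — "in a way similar to the proof of Lemma 6.1": the objects,
# the repaired display `Z22:§11.u024`, and its typed sub-steps (the §6 steps for `χψ mod Dp`)

Topic `Literature/NumberTheory/LFunctions/Zhang2022` (Landau–Siegel audit tree; verdict-neutral).
Y. Zhang, *Discrete mean estimates and the Landau–Siegel zero*, arXiv:2211.02515v1 (2022)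
[Zhang2022LandauSiegel] — **an unrefereed manuscript under adjudication; every `def … : Prop` below
is a CLAIM OF THE MANUSCRIPT (or its repair), STATED NOT ASSERTED** (campaign D-0069; typed ≠
discharged; nothing here bears on Theorems 1–2 or on Landau–Siegel zeros).

DAG node `Z22:§11.u024` (Z22 p. 65, tex L3329–3331, typed `Typed.TypedSection11B.Step11u024`): the
first display of the proof of Lemma 11.2, "In a way similar to the proof of Lemma 6.1, it can be
deduced that `Σ_n χψ(n)n^{−s}g(P^z/n) = L(s,χψ) − Z(s,χψ)Σ_n χψ̄(n)n^{−(1−s)}g(P^{1−z}Dt₀/n) +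
O(E₂(s,ψ))`" (`σ = 1/2`, `|t − 2πt₀| < 𝓛₁`, `0.5 ≤ z ≤ 0.504`). The proof by analogy is not carried
out in print. This file TYPES it the way §6 (proof of Lemma 6.1, tex L1707–1781) is typed in the
tree's `Section6Statements` — same objects with `(θ, X, R, N) = (χψ mod Dp, P^z, DPt₀, P₁)` in place
of `(ψ mod p, P₄, Pt₀, T³)` — and records ONE repair (the cell's gap candidate G·11d):

* Lemma 6.1's error `E₁(s,ψ)` CARRIES the term `+ε`, `ε = exp{−c𝓛¹⁰}` (tex L1703); the printed
  `E(s,ψ)` of Lemma 11.2 (tex L3324, the tree's `Skeleton.E2main`) does NOT, although the same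
  exponentially small truncation errors arise ((6.2): the tail `n ≥ P₁`; the Gaussian tails
  `|v| > 𝓛²⁰`; `g` versus its head). `Step11u024e` below is the display with `O(E₂ + ε)`;
  the print-verbatim `Step11u024` is NOT claimed derivable here.

Objects (§0): `bigR = DPt₀` ((5.4)), `kern X w = X^wω₁(w)/w`, `integrandL` (`L(s+w,χψ)·kern`),
`headPc`/`tailPc` (the reflected series split at `N`), `integrandHead/Tail/Main/Diff` (the (6.3),
(6.2), (6.4), (6.5) integrands), `smoothedSum`, `dualSum`, `dualHead`, `InRange112`.
Sub-steps (§3): `ShiftPole11` (= §6.u008: the line `u = 1` moved to `u = −1` across the pole at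
`w = 0`), `LineSplit11` (= §6.u009 + the tacit linearity), `TailSmall11` (= (6.2)), `WindowMove11`
(= (6.5): the segment `u = −1` moved to `u = 0`), `DualTail11` (completing the dual head; PROVED in
`Section11AFEDualTail`). The kernel blocks ((a) the line `u = 1` IS the smoothed sum; (e) `I′`
exact; (B2) the window is `O(E₂)` by Lemma 5.1 (5.4); (g)) and the assembly
`ShiftPole11 → LineSplit11 → TailSmall11 → WindowMove11 → Step11u024e` are in the companion files
`Section11AFEBlocks`, `Section11AFEDualTail`, `Section11AFEAssembly`. Small kernel lemmas here:
`psiChi_natCast` (`χψ(n) = χ(n)ψ(n)`), `LFunction_psiChi_eq_LSeries`, `kern_neg_line` (the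
`w → −w` reflection of the kernel), `norm_headPc_I` (`1 − s̄ = s` on `σ = 1/2`), `bigR_div_rpow`.

## References

* Y. Zhang, arXiv:2211.02515v1 (2022), §11 Lemma 11.2 and its proof, p. 65; §6 proof of Lemma 6.1,
  pp. 31–32; §5 (5.4); §4 (4.1)–(4.3). [cite: Zhang2022LandauSiegel, §11 Lemma 11.2; §6 Lemma 6.1]
-/

noncomputable section

open Complex Real ComplexConjugate MeasureTheory Set Filter Topology

namespace Literature.NumberTheory.LFunctions.Zhang2022.Section11AFE

open Skeleton GaussWeight Section6Statements

/-! ## §0. Objects -/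

section Objects

variable {D : ℕ} [NeZero D] (χ : DirichletCharacter ℂ D) (x : Chr D)

/-- `R = DPt₀`, the reflection length of (5.4): `Z(s+w,χψ) ≈ Z(s,χψ)(DPt₀)^{−w}`; the dual
weight of the display is `g(P^{1−z}Dt₀/n) = g(R/(P^z n))`. [cite: Zhang2022LandauSiegel, §5 (5.4); §11 p. 65] -/
def bigR (D : ℕ) : ℝ := (D : ℝ) * bigP D * t0 D

/-- The Perron kernel `X^w ω₁(w)/w`, `ω₁(w) = exp{w²/(4𝓛³⁰)}` (§4 p. 17; §6 with `X = P₄`, here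
`X = P^z`). [cite: Zhang2022LandauSiegel, §4 (4.1); §11 p. 65] -/
def kern (D : ℕ) (X : ℝ) (w : ℂ) : ℂ := ((X : ℝ) : ℂ) ^ w * omega1 (ell D ^ 30) w / w

/-- The integrand `L(s+w,χψ)X^w ω₁(w)/w` of the Perron integrals (the §11 analogue of §6's
`∫_{(±1)} L(s+w,ψ)P₄^w ω₁(w)dw/w`). [cite: Zhang2022LandauSiegel, §6 p. 31; §11 p. 65] -/
def integrandL (X : ℝ) (s w : ℂ) : ℂ := (psiChi χ x).LFunction (s + w) * kern D X w

/-- The head `Σ_{n<N} \overline{χψ}(n) n^{−(1−s−w)}` of the reflected series (§6 p. 31 with `T³`;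
here `N = P₁`). [cite: Zhang2022LandauSiegel, §6 p. 31; §11 p. 65] -/
def headPc (N : ℝ) (s w : ℂ) : ℂ :=
  ∑ n ∈ Finset.Ico 1 ⌈N⌉₊, conj (pc χ x n) * (n : ℂ) ^ (-(1 - s - w))

/-- The tail `Σ_{n≥N} \overline{χψ}(n) n^{−(1−s−w)}` of the reflected series (absolutely convergent
for `Re(1−s−w) > 1`). [cite: Zhang2022LandauSiegel, §6 p. 31; §11 p. 65] -/
def tailPc (N : ℝ) (s w : ℂ) : ℂ :=
  ∑' n : ℕ, if (⌈N⌉₊ : ℕ) ≤ n then conj (pc χ x n) * (n : ℂ) ^ (-(1 - s - w)) else 0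

/-- `Z(s+w,χψ)·head·X^wω₁(w)/w` (the (6.3)-analogue integrand). [cite: Zhang2022LandauSiegel, §6 (6.3)] -/
def integrandHead (X N : ℝ) (s w : ℂ) : ℂ := Zpc χ x (s + w) * headPc χ x N s w * kern D X w

/-- `Z(s+w,χψ)·tail·X^wω₁(w)/w` (the (6.2)-analogue integrand). [cite: Zhang2022LandauSiegel, §6 (6.2)] -/
def integrandTail (X N : ℝ) (s w : ℂ) : ℂ := Zpc χ x (s + w) * tailPc χ x N s w * kern D X w

/-- `Z(s,χψ)R^{−w}·head·X^wω₁(w)/w` (the (6.4)-analogue integrand, `I′`).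
[cite: Zhang2022LandauSiegel, §6 (6.4)] -/
def integrandMain (X N : ℝ) (s w : ℂ) : ℂ :=
  Zpc χ x s * ((bigR D : ℝ) : ℂ) ^ (-w) * headPc χ x N s w * kern D X w

/-- `(Z(s+w,χψ) − Z(s,χψ)R^{−w})·head·X^wω₁(w)/w` (the (6.5)-analogue integrand, `I″`).
[cite: Zhang2022LandauSiegel, §6 (6.5)] -/
def integrandDiff (X N : ℝ) (s w : ℂ) : ℂ :=
  (Zpc χ x (s + w) - Zpc χ x s * ((bigR D : ℝ) : ℂ) ^ (-w)) * headPc χ x N s w * kern D X w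

/-- The smoothed sum `Σ_n χψ(n)n^{−s}g(X/n)` (left side of the display, `X = P^z`).
[cite: Zhang2022LandauSiegel, §11 p. 65] -/
def smoothedSum (X : ℝ) (s : ℂ) : ℂ := ∑' n : ℕ, pc χ x n * (n : ℂ) ^ (-s) * (gW D (X / n) : ℂ)

/-- The dual sum `Σ_n \overline{χψ}(n)n^{−(1−s)}g(Y/n)` (`Y = P^{1−z}Dt₀ = R/X`).
[cite: Zhang2022LandauSiegel, §11 p. 65] -/
def dualSum (Y : ℝ) (s : ℂ) : ℂ :=
  ∑' n : ℕ, conj (pc χ x n) * (n : ℂ) ^ (-(1 - s)) * (gW D (Y / n) : ℂ)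

/-- The head `n < N` of the dual sum. [cite: Zhang2022LandauSiegel, §11 p. 65] -/
def dualHead (Y N : ℝ) (s : ℂ) : ℂ :=
  ∑ n ∈ Finset.Ico 1 ⌈N⌉₊, conj (pc χ x n) * (n : ℂ) ^ (-(1 - s)) * (gW D (Y / n) : ℂ)

/-- The standing range of Lemma 11.2: `σ = 1/2`, `|t − 2πt₀| < 𝓛₁`. [cite: Zhang2022LandauSiegel, §11 Lemma 11.2] -/
def InRange112 (D : ℕ) (s : ℂ) : Prop := s.re = 1 / 2 ∧ |s.im - 2 * π * t0 D| < ell1 D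

end Objects

/-! ## §1. The values of `χψ` and its `L`-series -/

section Values

variable {D : ℕ} [NeZero D] (χ : DirichletCharacter ℂ D) (x : Chr D)

/-- `χψ(n) = χ(n)ψ(n)` for the product character `ψχ (mod Dp)` (§4 p. 8: "`χψ` is a primitive
character (mod `Dp`)"): on units by `changeLevel`, and both sides vanish at non-units.
[cite: Zhang2022LandauSiegel, §4 p. 8] -/
theorem psiChi_natCast (n : ℕ) : psiChi χ x (n : ZMod (D * x.p)) = pc χ x n := by
  rw [psiChi, pc, MulChar.mul_apply]
  by_cases hu : IsUnit (n : ZMod (D * x.p))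
  · obtain ⟨u, hu'⟩ := hu
    rw [← hu', DirichletCharacter.changeLevel_eq_cast_of_dvd χ (dvd_mul_right D x.p) u,
      DirichletCharacter.changeLevel_eq_cast_of_dvd x.ψ (dvd_mul_left x.p D) u, hu',
      ZMod.cast_natCast (dvd_mul_right D x.p), ZMod.cast_natCast (dvd_mul_left x.p D), mul_comm]
  · rw [MulChar.map_nonunit _ hu, zero_mul]
    -- `n` is not coprime to `Dp`, so not coprime to `D` or to `p`
    have hnc : ¬ Nat.Coprime n (D * x.p) := fun h => hu ((ZMod.isUnit_iff_coprime n _).2 h)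
    by_cases hD : Nat.Coprime n D
    · have hp : ¬ Nat.Coprime n x.p := fun h => hnc (Nat.Coprime.mul_right hD h)
      have : ¬ IsUnit (n : ZMod x.p) := fun h => hp ((ZMod.isUnit_iff_coprime n _).1 h)
      rw [MulChar.map_nonunit _ this, zero_mul]
    · have : ¬ IsUnit (n : ZMod D) := fun h => hD ((ZMod.isUnit_iff_coprime n _).1 h)
      rw [MulChar.map_nonunit _ this, mul_zero]

/-- For `Re w > 1`, `L(w,χψ) = Σ_n χψ(n)n^{−w}` as an `L`-series with coefficients `pc`.
[cite: Zhang2022LandauSiegel, §2 (2.2)] -/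
theorem LFunction_psiChi_eq_LSeries {w : ℂ} (hw : 1 < w.re) :
    (psiChi χ x).LFunction w = LSeries (fun n => pc χ x n) w := by
  rw [DirichletCharacter.LFunction_eq_LSeries _ hw]
  exact LSeries_congr (fun {n} _ => psiChi_natCast χ x n) w

end Values

/-! ## §2. Small kernel lemmas: the kernel reflection, `ω₁`, `E₂ ≥ 0`, the head on `σ = 1/2` -/

section Small

variable {D : ℕ} [NeZero D] (χ : DirichletCharacter ℂ D) (x : Chr D)

/-- `ω₁` is even. [cite: Zhang2022LandauSiegel, §4 (4.1)] -/
theorem omega1_neg (Λ : ℝ) (w : ℂ) : omega1 Λ (-w) = omega1 Λ w := by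
  simp [omega1]

/-- `a^w b^w = (ab)^w` for positive reals `a, b` (used for `R^{−w}X^{w} = (X/R)^{w}`, §6 p. 32: "Note that `Pt₀/P₄ = T²`"). [cite: Zhang2022LandauSiegel, §6 p. 32] -/
theorem cpow_ofReal_mul_cpow_ofReal {a b : ℝ} (ha : 0 < a) (hb : 0 < b) (w : ℂ) :
    ((a : ℝ) : ℂ) ^ w * ((b : ℝ) : ℂ) ^ w = ((a * b : ℝ) : ℂ) ^ w := by
  rw [cpow_eq_exp_log ha, cpow_eq_exp_log hb, cpow_eq_exp_log (mul_pos ha hb), ← Complex.exp_add,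
    Real.log_mul ha.ne' hb.ne']
  push_cast
  ring_nf

/-- `a^{−w} = (a⁻¹)^w` for a positive real `a` (the substitution `w → −w` of §6 p. 32). [cite: Zhang2022LandauSiegel, §6 p. 32] -/
theorem cpow_ofReal_neg {a : ℝ} (ha : 0 < a) (w : ℂ) :
    ((a : ℝ) : ℂ) ^ (-w) = ((a⁻¹ : ℝ) : ℂ) ^ w := by
  rw [cpow_eq_exp_log ha, cpow_eq_exp_log (inv_pos.mpr ha), Real.log_inv]
  push_cast
  ring_nf

omit [NeZero D] in
/-- The kernel on the left line is minus the right-line kernel at the reflected point: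
`X^w ω₁(w)/w` at `w = −c + it` equals `−K_{X⁻¹}(−t)` with `K` the tree's `GaussWeight.kernel` at
abscissa `c` ("using the change of variable `w → −w`", §6 p. 32).
[cite: Zhang2022LandauSiegel, §6 p. 32] -/
theorem kern_neg_line {X : ℝ} (hX : 0 < X) (c t : ℝ) :
    kern D X (((-c : ℝ) : ℂ) + (t : ℂ) * I) = -kernel (ell D ^ 30) c X⁻¹ (-t) := by
  have hw : (((-c : ℝ) : ℂ) + (t : ℂ) * I) = -(((c : ℝ) : ℂ) + ((-t : ℝ) : ℂ) * I) := by
    push_cast; ring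
  rw [kern, kernel, hw, cpow_ofReal_neg hX, omega1_neg, div_neg]

omit [NeZero D] in
/-- `|ω₁(iv)| = exp{−v²/(4𝓛³⁰)}`. [cite: Zhang2022LandauSiegel, §4 (4.1)] -/
theorem norm_omega1_I (Λ v : ℝ) : ‖omega1 Λ ((v : ℂ) * I)‖ = Real.exp (-(v ^ 2) / (4 * Λ)) := by
  have h := norm_omega1 Λ 0 v
  simp only [Complex.ofReal_zero, zero_add] at h
  rw [h]
  congr 1
  ring

omit [NeZero D] in
/-- `E₂(s,ψ) ≥ 0`. [cite: Zhang2022LandauSiegel, §11 Lemma 11.2] -/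
theorem E2main_nonneg (s : ℂ) : 0 ≤ E2main χ x s := by
  have hℓ : 0 ≤ ell D := Real.log_natCast_nonneg D
  refine mul_nonneg (inv_nonneg.mpr (pow_nonneg hℓ _)) ?_
  refine intervalIntegral.integral_nonneg (by linarith [pow_nonneg hℓ 20]) fun v _ => ?_
  exact mul_nonneg (norm_nonneg _) (Real.exp_nonneg _)

omit [NeZero D] in
/-- On `σ = 1/2` the head at `w = iv` is the conjugate of the `E₂`-polynomial:
`‖Σ_{n<N} \overline{χψ}(n)n^{−(1−s−iv)}‖ = ‖Σ_{n<N} χψ(n)n^{−(s+iv)}‖` (`1 − s̄ = s`).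
[cite: Zhang2022LandauSiegel, §6 p. 32 ("applying Lemma 5.1 … ≪ E₁(s,ψ)")] -/
theorem norm_headPc_I {s : ℂ} (hs : s.re = 1 / 2) (N : ℝ) (v : ℝ) :
    ‖headPc χ x N s ((v : ℂ) * I)‖ =
      ‖∑ n ∈ Finset.Ico 1 ⌈N⌉₊, pc χ x n * (n : ℂ) ^ (-(s + v * I))‖ := by
  have hconj : headPc χ x N s ((v : ℂ) * I) =
      conj (∑ n ∈ Finset.Ico 1 ⌈N⌉₊, pc χ x n * (n : ℂ) ^ (-(s + v * I))) := by
    rw [headPc, map_sum]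
    refine Finset.sum_congr rfl fun n _ => ?_
    rw [map_mul]
    congr 1
    have harg : (n : ℂ).arg ≠ π := by rw [Complex.natCast_arg]; exact Real.pi_ne_zero.symm
    have hz : -(1 - s - (v : ℂ) * I) = conj (-(s + v * I)) := by
      apply Complex.ext
      · simp; linarith
      · simp
    rw [hz, Complex.cpow_conj _ _ harg, Complex.conj_natCast]
  rw [hconj, Complex.norm_conj]

/-- `P^{1−z}Dt₀ = R/P^z` (`R = DPt₀`). [cite: Zhang2022LandauSiegel, §11 p. 65] -/
theorem bigR_div_rpow (D : ℕ) (z : ℝ) : bigR D / bigP D ^ z = bigP D ^ (1 - z) * (D : ℝ) * t0 D := by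
  have hP : 0 < bigP D := Real.exp_pos _
  rw [bigR, Real.rpow_sub hP, Real.rpow_one]
  field_simp


end Small

/-! ## §3. The repaired display and the typed sub-steps of "in a way similar to the proof of Lemma 6.1" -/

section Claims

/-- **`Z22:§11.u024`, REPAIRED (the cell's gap candidate G·11d).** The first display of the proof of
Lemma 11.2 (Z22 p.65, tex L3329–3331) — "In a way similar to the proof of Lemma 6.1, it can be
deduced that `Σ_n χψ(n)n^{−s}g(P^z/n) = L(s,χψ) − Z(s,χψ)Σ_n χψ̄(n)n^{−(1−s)}g(P^{1−z}Dt₀/n)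
+ O(E₂(s,ψ))`" — with the error term of Lemma 6.1's shape: `O(E₂(s,ψ) + ε)`, `ε = exp{−c𝓛¹⁰}`
(Lemma 6.1's `E₁` carries `+ε`, tex L1703; the printed `E` of Lemma 11.2, tex L3324 =
`Skeleton.E2main`, does not). Identical to `Typed.TypedSection11B.Step11u024` except for the
`+ Real.exp (−c·𝓛¹⁰)`. CLAIM of the manuscript as repaired; `step11u024e_of` below derives it from the
sub-steps (b), (d), (f) and the kernel blocks of this file. [cite: Zhang2022LandauSiegel, §11 Lemma 11.2 (proof), p. 65] -/
def Step11u024e : Prop :=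
  ∃ c : ℝ, 0 < c ∧ ∃ C : ℝ, ForAllLarge fun D _ χ => AssumptionA D χ → ∀ x : Chr D, ∀ s : ℂ,
    s.re = 1 / 2 → |s.im - 2 * π * t0 D| < ell1 D → ∀ z : ℝ, 0.5 ≤ z → z ≤ 0.504 →
      ‖(∑' n : ℕ, pc χ x n * (n : ℂ) ^ (-s) * (gW D (bigP D ^ z / (n : ℝ)) : ℂ)) -
          ((psiChi χ x).LFunction s -
            Zpc χ x s * ∑' n : ℕ, conj (pc χ x n) * (n : ℂ) ^ (-(1 - s)) *
              (gW D (bigP D ^ (1 - z) * (D : ℝ) * t0 D / (n : ℝ)) : ℂ))‖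
        ≤ C * (E2main χ x s + Real.exp (-c * ell D ^ 10))

/-- **Sub-step (b) of `Z22:§11.u024`** = the §6 step `Z22:§6.u008` (tex L1711) for `χψ`: "The left side
above is, by moving the line of integration to `u = −1`, equal to `L(s,χψ) + (1/2πi)∫_{(−1)}
L(s+w,χψ)X^wω₁(w)dw/w`" (`X = P^z`; the residue of `L(s+w,χψ)X^wω₁(w)/w` at `w = 0` is `L(s,χψ)`),
for `ψ ∈ Ψ`, `σ = 1/2`, `|t − 2πt₀| < 𝓛₁`, `0.5 ≤ z ≤ 0.504`, `D` large. CLAIM (standard: the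
integrand is `L(s+w,χψ)` — polynomial growth on vertical strips, the tree's
`StripGrowth.exists_norm_LFunction_le_pow` — times the Gaussian `ω₁`).
[cite: Zhang2022LandauSiegel, §6 p. 31, tex L1711; §11 p. 65] -/
def ShiftPole11 : Prop :=
  ForAllLarge fun D _ χ => ∀ x : Chr D, ∀ s : ℂ, InRange112 D s → ∀ z : ℝ, 0.5 ≤ z → z ≤ 0.504 →
    vline (integrandL χ x (bigP D ^ z) s) 1 =
      (psiChi χ x).LFunction s + vline (integrandL χ x (bigP D ^ z) s) (-1)

/-- **Sub-step (c) of `Z22:§11.u024`** = the §6 step `Z22:§6.u009` (tex L1724) and the tacit linearity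
of `Z22:Lem6.1.pf` (tex L1754) for `χψ`: on `u = −1`, "by the functional equation (2.2),
`L(s+w,χψ) = Z(s+w,χψ)(Σ_{n<P₁} + Σ_{n≥P₁})χψ̄(n)n^{−(1−s−w)}`", and the line integral splits
accordingly: `∫_{(−1)}L·kern = ∫_{(−1)}Z·head·kern + ∫_{(−1)}Z·tail·kern`,
`∫_{(−1)}Z·head·kern = ∫_{(−1)}Z(s)R^{−w}·head·kern + ∫_{(−1)}(Z(s+w)−Z(s)R^{−w})·head·kern` (the
integrands are integrable: `|Z(−1/2+iτ,χψ)|` has polynomial growth, the tree's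
`StripGrowth.exists_norm_Zfac_le`, against the Gaussian `ω₁`). CLAIM.
[cite: Zhang2022LandauSiegel, §6 p. 31, tex L1724; §11 p. 65] -/
def LineSplit11 : Prop :=
  ForAllLarge fun D _ χ => ∀ x : Chr D, ∀ s : ℂ, InRange112 D s → ∀ z : ℝ, 0.5 ≤ z → z ≤ 0.504 →
    vline (integrandL χ x (bigP D ^ z) s) (-1) =
        vline (integrandHead χ x (bigP D ^ z) (Skeleton.P1 D) s) (-1) +
          vline (integrandTail χ x (bigP D ^ z) (Skeleton.P1 D) s) (-1) ∧
      vline (integrandHead χ x (bigP D ^ z) (Skeleton.P1 D) s) (-1) =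
        vline (integrandMain χ x (bigP D ^ z) (Skeleton.P1 D) s) (-1) +
          vline (integrandDiff χ x (bigP D ^ z) (Skeleton.P1 D) s) (-1)

/-- **Sub-step (d) of `Z22:§11.u024`** = the §6 display `Z22:(6.2)` (tex L1729–1754, "whence (6.2)
follows") for `χψ`: "`∫_{(−1)} Z(s+w,χψ)(Σ_{n≥P₁}χψ̄(n)n^{−(1−s−w)})X^wω₁(w)dw/w ≪ ε`",
`ε = exp{−c𝓛¹⁰}` (contour moved to `u = −𝓛⁹`, `|v| ≤ 𝓛²⁰`: there `|Z(s+w,χψ)X^w| ≤ 4(Dp)^{𝓛⁹+1}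
τ^{𝓛⁹+1}X^{−𝓛⁹}`, the tree's `StripGrowth.norm_Zfac_le`, and `|Σ_{n≥P₁}| ≤ 2P₁^{1/2−𝓛⁹}`, with
`DpτP₁/(XP₁) ≤ 2πD𝓛⁵¹⁹P^{1−z−0.504} < 1/2`; the pieces `|v| > 𝓛²⁰` by the Gaussian). CLAIM.
[cite: Zhang2022LandauSiegel, §6 (6.2) pp. 31–32; §11 p. 65] -/
def TailSmall11 : Prop :=
  ∃ c : ℝ, 0 < c ∧ ∃ C : ℝ, ForAllLarge fun D _ χ => ∀ x : Chr D, ∀ s : ℂ, InRange112 D s →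
    ∀ z : ℝ, 0.5 ≤ z → z ≤ 0.504 →
      ‖vline (integrandTail χ x (bigP D ^ z) (Skeleton.P1 D) s) (-1)‖ ≤ C * Real.exp (-c * ell D ^ 10)

/-- **Sub-step (f) of `Z22:§11.u024`** = the §6 step `Z22:Lem6.1.pf` (6.5) (tex L1769–1778) for `χψ`:
"moving the segment `u = −1`, `|v| ≤ 𝓛²⁰` to `u = 0`, `|v| ≤ 𝓛²⁰`" — the `I″`-integral over the line
`u = −1` equals the window integral over `u = 0`, `|v| ≤ 𝓛²⁰` up to `O(ε)` (no pole: the integrand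
`(Z(s+w,χψ) − Z(s,χψ)R^{−w})/w` is regular at `w = 0`; the horizontal segments `|v| = 𝓛²⁰` and the
half-lines `|v| > 𝓛²⁰` are `≪ ε` by `|ω₁(u+iv)| = exp{(u²−v²)/4𝓛³⁰}`). CLAIM.
[cite: Zhang2022LandauSiegel, §6 (6.5) p. 32; §11 p. 65] -/
def WindowMove11 : Prop :=
  ∃ c : ℝ, 0 < c ∧ ∃ C : ℝ, ForAllLarge fun D _ χ => ∀ x : Chr D, ∀ s : ℂ, InRange112 D s →
    ∀ z : ℝ, 0.5 ≤ z → z ≤ 0.504 →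
      ‖vline (integrandDiff χ x (bigP D ^ z) (Skeleton.P1 D) s) (-1) -
          vseg (integrandDiff χ x (bigP D ^ z) (Skeleton.P1 D) s) 0 (ell D ^ 20)‖
        ≤ C * Real.exp (-c * ell D ^ 10)

/-- **Sub-step (g) of `Z22:§11.u024`** (tacit in §6: `g*` truncates `g`): completing the dual head
`n < P₁` to the full dual sum costs `O(ε)` — "`g(x) = O(exp{−𝓛³⁰log²x})` if `x ≤ 1`" (4.3) with
`P^{1−z}Dt₀/n ≤ Dt₀P^{−0.004}` for `n ≥ P₁`. CLAIM (proved below: `dualTail11_holds`).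
[cite: Zhang2022LandauSiegel, §4 (4.3); §11 p. 65] -/
def DualTail11 : Prop :=
  ∃ c : ℝ, 0 < c ∧ ∃ C : ℝ, ForAllLarge fun D _ χ => ∀ x : Chr D, ∀ s : ℂ, InRange112 D s →
    ∀ z : ℝ, 0.5 ≤ z → z ≤ 0.504 →
      ‖Zpc χ x s * (dualSum χ x (bigR D / bigP D ^ z) s -
          dualHead χ x (bigR D / bigP D ^ z) (Skeleton.P1 D) s)‖ ≤ C * Real.exp (-c * ell D ^ 10)

end Claims

end Literature.NumberTheory.LFunctions.Zhang2022.Section11AFE
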